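/-
Copyright (c) 2026 the pub-hodgecm-mathlib formalisation cell (harness21).  Prover seat hodgecm-mathlib-LH4-p07 (g7), Track A «(D-RAM) FOUR-FRAME», unit U2H, the census leaf
(ρ2b′-X) `stub_U2H_fixedPointCensus_typeTwo_unit0` — the typed bottom sockets (A)∕(B)∕(C) (payer LH4-p14 (g4) MAP v3): the choice of `V ∈ 𝓝 1`, i.e. the m-TOKEN DEPTH tends
to infinity near `1 ∈ H_v`.  2026-09-04.
-/
import Summits.HodgeConjecture.HodgeConjecture.Theorems.F0P3cDyRamRowOneRootDepth   -- ★ `setOf_valued_sub_le_mem_nhds`; brings ★ `continuous_eval_finCharpolyTwo`, `toPlace_heckeUniformizer_ne_zero`, `valued_toPlace_heckeUniformizer_pow_lt_one`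
import HarnessLib

/-!
# The m-token depth tends to infinity near `1 ∈ H_v`

The three typed bottom sockets of the (ρ2b′-X) census begin `∃ V ∈ 𝓝 (1 : H_v), ∀ γH ∈ V, …` and bind, for each `γH`, the m-TOKEN `m : ℕ` through the clause
`|χ_g(u)_w| = |ι_w ϖ_v ^ m|_w` (`χ_g = finCharpolyTwo`, `u = finGammaTwo`).  The bottom prover chooses `V`; what the T5s sums need from it is a LOWER BOUND on `m`
(the tube radii `d − d%2 ≤ m + 1`, `3d ≤ jl + 2 + 2(d%2)`, … with `m ≤ jl`).  THIS FILE supplies that choice once, type-free: since `γH ↦ χ_g(u)` is continuous (★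
`continuous_eval_finCharpolyTwo`) and vanishes at `γH = 1` (`χ_1 = (X − 1)²`, `u = 1`), for every `N₀` the set of `γH` with `|χ_g(u)_w| ≤ |ι_w ϖ_v ^ N₀|_w` is a
neighbourhood of `1`, on which any m-token satisfies `N₀ ≤ m` (`|ι_w ϖ_v| < 1`).
* `eval_finCharpolyTwo_finGammaTwo_one` — `χ_g(u) = 0` at `γH = 1`.
* `eventually_nhds_one_valued_eval_finCharpolyTwo_le` — eventually `|χ_g(u)_w| ≤ |c|_w` (`c ≠ 0`).
* `eventually_nhds_one_le_tokenDepth` — eventually every m-token is `≥ N₀`; `exists_nhds_one_le_tokenDepth` — the same as `∃ V ∈ 𝓝 1`.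
HONEST LABEL: HC_CM is proved only modulo the 7 printed citations (2 remaining named inputs: hLiu418 = stmt-HodgeConjecture-24832,
h413 = stmt-HodgeConjecture-24833) until rung 0 closes; (ρ2b′-X) :418 is an OPEN prover target — this file is a helper (`--supports`), proofs only, closes no socket.
-/

set_option autoImplicit false

noncomputable section

namespace Summit.HodgeConjecture.HodgeConjecture.Cruxes.H413.F0P3cDyRamTokenDepthNearOne

open NumberField IsDedekindDomain Filter Topology Polynomial
open Literature.NumberTheory.Automorphic Literature.NumberTheory.Automorphic.UnitaryGroup Literature.NumberTheory.GaloisRepresentations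
open Literature.NumberTheory.Rogawski1990
open Summit.HodgeConjecture.HodgeConjecture.Cruxes.H413.F0P3cDyRamRowOneRootDepth (setOf_valued_sub_le_mem_nhds)
open scoped Valued WithZero Matrix MatrixGroups

variable (L : Type) [Field L] [NumberField L] [IsCMField L] (v : HeightOneSpectrum (𝓞 ↥(maximalRealSubfield L)))
  (w : PlacesOver L v)

/-- **`χ_g(u) = 0` AT `γH = 1`**: the characteristic polynomial of the identity `2 × 2` matrix is `(X − 1)²` and the `U(1)`-token is `u = 1`. [cite: Rogawski1990, §4.9 p. 55] -/
theorem eval_finCharpolyTwo_finGammaTwo_one :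
    (finCharpolyTwo L v (1 : (cmDatum L 2 (Matrix.of fun i j : Fin 2 => if i.val + j.val + 1 = 2 then (1 : L) else 0)).Local v ×
        (cmDatum L 1 (Matrix.of fun i j : Fin 1 => if i.val + j.val + 1 = 1 then (1 : L) else 0)).Local v)).eval
      (finGammaTwo L v (1 : (cmDatum L 2 (Matrix.of fun i j : Fin 2 => if i.val + j.val + 1 = 2 then (1 : L) else 0)).Local v ×
        (cmDatum L 1 (Matrix.of fun i j : Fin 1 => if i.val + j.val + 1 = 1 then (1 : L) else 0)).Local v)) = 0 := by
  have hu : finGammaTwo L v (1 : (cmDatum L 2 (Matrix.of fun i j : Fin 2 => if i.val + j.val + 1 = 2 then (1 : L) else 0)).Local v ×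
      (cmDatum L 1 (Matrix.of fun i j : Fin 1 => if i.val + j.val + 1 = 1 then (1 : L) else 0)).Local v) = 1 := by
    change (1 : Matrix (Fin 1) (Fin 1) (LocalRing L v)) 0 0 = 1
    rw [Matrix.one_apply_eq]
  have hχ : finCharpolyTwo L v (1 : (cmDatum L 2 (Matrix.of fun i j : Fin 2 => if i.val + j.val + 1 = 2 then (1 : L) else 0)).Local v ×
      (cmDatum L 1 (Matrix.of fun i j : Fin 1 => if i.val + j.val + 1 = 1 then (1 : L) else 0)).Local v) = (1 : Matrix (Fin 2) (Fin 2) (LocalRing L v)).charpoly := rfl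
  rw [hu, hχ, Matrix.charpoly_one]
  simp

/-- **EVENTUALLY NEAR `1 ∈ H_v`: `|χ_g(u)_w| ≤ |c|_w`** (`c ≠ 0`): `γ_H ↦ χ_g(u)` is continuous (★ `continuous_eval_finCharpolyTwo`) and vanishes at `γ_H = 1`.
[cite: Rogawski1990, §4.9 p. 55; Prop. 8.1.3 p. 116] [cite: Serre1979, Ch. II §1] -/
theorem eventually_nhds_one_valued_eval_finCharpolyTwo_le {c : w.1.adicCompletion L} (hc : c ≠ 0) :
    ∀ᶠ γH : (cmDatum L 2 (Matrix.of fun i j : Fin 2 => if i.val + j.val + 1 = 2 then (1 : L) else 0)).Local v ×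
        (cmDatum L 1 (Matrix.of fun i j : Fin 1 => if i.val + j.val + 1 = 1 then (1 : L) else 0)).Local v in 𝓝 1,
      Valued.v (((finCharpolyTwo L v γH).eval (finGammaTwo L v γH)) w) ≤ Valued.v c := by
  have hct : Continuous fun γH : (cmDatum L 2 (Matrix.of fun i j : Fin 2 => if i.val + j.val + 1 = 2 then (1 : L) else 0)).Local v ×
        (cmDatum L 1 (Matrix.of fun i j : Fin 1 => if i.val + j.val + 1 = 1 then (1 : L) else 0)).Local v =>
      ((finCharpolyTwo L v γH).eval (finGammaTwo L v γH)) w :=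
    (continuous_apply w).comp (continuous_eval_finCharpolyTwo L v)
  have h1 : ((finCharpolyTwo L v (1 : (cmDatum L 2 (Matrix.of fun i j : Fin 2 => if i.val + j.val + 1 = 2 then (1 : L) else 0)).Local v ×
        (cmDatum L 1 (Matrix.of fun i j : Fin 1 => if i.val + j.val + 1 = 1 then (1 : L) else 0)).Local v)).eval
      (finGammaTwo L v (1 : (cmDatum L 2 (Matrix.of fun i j : Fin 2 => if i.val + j.val + 1 = 2 then (1 : L) else 0)).Local v ×
        (cmDatum L 1 (Matrix.of fun i j : Fin 1 => if i.val + j.val + 1 = 1 then (1 : L) else 0)).Local v))) w = 0 := by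
    rw [eval_finCharpolyTwo_finGammaTwo_one, Pi.zero_apply]
  have hball := setOf_valued_sub_le_mem_nhds L v w hc (0 : w.1.adicCompletion L)
  have h := hct.continuousAt.preimage_mem_nhds (by rw [h1]; exact hball)
  filter_upwards [h] with γH hγ
  simpa only [Set.mem_preimage, Set.mem_setOf_eq, sub_zero] using hγ

/-- **EVENTUALLY NEAR `1 ∈ H_v`, EVERY m-TOKEN IS `≥ N₀`.**  If `|χ_g(u)_w| = |ι_w ϖ_v ^ m|_w` for some `γ_H` close enough to `1`, then `N₀ ≤ m`
(`|ι_w ϖ_v| < 1`, and `|χ_g(u)_w| ≤ |ι_w ϖ_v ^ N₀|_w` there). [cite: Rogawski1990, §4.9 p. 55; Prop. 8.1.3 p. 116] [cite: Serre1979, Ch. II §1] -/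
theorem eventually_nhds_one_le_tokenDepth (N₀ : ℕ) :
    ∀ᶠ γH : (cmDatum L 2 (Matrix.of fun i j : Fin 2 => if i.val + j.val + 1 = 2 then (1 : L) else 0)).Local v ×
        (cmDatum L 1 (Matrix.of fun i j : Fin 1 => if i.val + j.val + 1 = 1 then (1 : L) else 0)).Local v in 𝓝 1,
      ∀ m : ℕ, Valued.v (((finCharpolyTwo L v γH).eval (finGammaTwo L v γH)) w) =
          Valued.v ((toPlace v w (HeckeCharacter.uniformizer ↥(maximalRealSubfield L) v : v.adicCompletion ↥(maximalRealSubfield L))) ^ m) →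
        N₀ ≤ m := by
  set ϖF : w.1.adicCompletion L :=
    toPlace v w (HeckeCharacter.uniformizer ↥(maximalRealSubfield L) v : v.adicCompletion ↥(maximalRealSubfield L)) with hϖFdef
  have hϖF0 : ϖF ≠ 0 := toPlace_heckeUniformizer_ne_zero L v w
  have hϖF1 : Valued.v ϖF < 1 := by
    have h := valued_toPlace_heckeUniformizer_pow_lt_one L v w (M := 1) le_rfl
    rwa [pow_one] at h
  filter_upwards [eventually_nhds_one_valued_eval_finCharpolyTwo_le L v w (pow_ne_zero N₀ hϖF0)] with γH hγ m hm
  rw [hm, map_pow, map_pow] at hγ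
  exact le_of_not_gt fun hlt => absurd hγ (not_le.2 (pow_lt_pow_right_of_lt_one₀ ((Valuation.pos_iff _).2 hϖF0) hϖF1 hlt))

/-- **THE BOTTOM PROVER'S `V`**: there is `V ∈ 𝓝 (1 : H_v)` on which every m-token is `≥ N₀`. [cite: Rogawski1990, §4.9 p. 55; Prop. 8.1.3 p. 116] -/
theorem exists_nhds_one_le_tokenDepth (N₀ : ℕ) :
    ∃ V ∈ 𝓝 (1 : (cmDatum L 2 (Matrix.of fun i j : Fin 2 => if i.val + j.val + 1 = 2 then (1 : L) else 0)).Local v ×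
        (cmDatum L 1 (Matrix.of fun i j : Fin 1 => if i.val + j.val + 1 = 1 then (1 : L) else 0)).Local v),
      ∀ γH ∈ V, ∀ m : ℕ, Valued.v (((finCharpolyTwo L v γH).eval (finGammaTwo L v γH)) w) =
          Valued.v ((toPlace v w (HeckeCharacter.uniformizer ↥(maximalRealSubfield L) v : v.adicCompletion ↥(maximalRealSubfield L))) ^ m) →
        N₀ ≤ m :=
  Filter.Eventually.exists_mem (eventually_nhds_one_le_tokenDepth L v w N₀)

end Summit.HodgeConjecture.HodgeConjecture.Cruxes.H413.F0P3cDyRamTokenDepthNearOne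

end
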